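import Literature.Geometry.Kaehler.ComplexTorusAbelianSurfaceRealMultiplicationHodgeLieAlgebra
import Literature.Geometry.Kaehler.ComplexTorusHodgeGroupDeterminedByLieAlgebra
import Literature.Geometry.Kaehler.ComplexTorusLefschetzGroupReductive
import Literature.Geometry.Kaehler.ComplexTorusStablyNondegenerateIffHodgeEqLefschetzEndomorphismTypes
import HarnessLib

/-!
# Moonen–Zarhin 1999 (2.2), Type I(2): `Hg(X) = Lf(X) (= Res_{F/ℚ} SL_{2,F})` for a polarised abelian SURFACE
# with multiplication by a REAL QUADRATIC FIELD — `𝔤 = 𝔩𝔣_ℂ`, `Hg(X)(ℂ) = Lf(X)(ℂ)`, `Hg(X)(ℝ) = Lf(X)(ℝ)`, and hence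
# `X` is STABLY NONDEGENERATE (every power `Xⁿ` satisfies the Hodge conjecture, all Hodge classes being divisor-generated)

Layer `Literature/Geometry/Kaehler`, namespace `Literature.Geometry.Kaehler.ComplexTorus`; lane `lit-hodgefound`
(Track 2 foundations library), Layer A4, prover seat p17 (generation 47), self-proposed row g47-#10 — the conclusion
of the Type I(2) programme (g47-#4 … g47-#9).  THEOREMS ONLY (no definition, no instance, no notation, no named fact;
D-0026, net debt 0).  Consumed BY NAME: g47-#9 `IsRiemannForm.exists_mem_hodgeGroupLieC_forall_mulVec_eq_of_trace_eq_zero`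
(`𝔤 ⊇ 𝔰𝔩(V_σ) × 𝔰𝔩(V_τ)`), g47-#8 (`𝔩𝔣_ℂ ⊆ ∏ 𝔰𝔩(V_σ)`, `rosati_eq_self_of_range_eq`), skel-4's `lefschetzLieC` with
`IsRiemannForm.hodgeGroupLieC_subset_lefschetzLieC` and `mem_lefschetzLieC_iff_forall_exp_mem_lefschetzIdentityC`
(`ComplexTorusLefschetzLieAlgebra`), g39's «a connected algebraic group is determined by its Lie algebra»
(`map_toGL_hodgeGroupC_eq_iff_hodgeGroupComplexLie_eq_lieSubalgebraGL`, `ComplexTorusHodgeGroupDeterminedByLieAlgebra`;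
`isZConnected_map_toGL_lefschetzIdentityC`, `ComplexTorusLefschetzGroupReductive`; `mem_lieAlgebraGL_iff_forall_real_exp_smul_mem`),
and the stably-nondegenerate criterion for commutative `End⁰(X)`
(`IsRiemannForm.forall_divisorClasses_powPeriod_eq_hodgeClasses_iff_hodgeGroup_eq_lefschetzIdentity_of_endAlgRat_comm`).

## Sources, VERBATIM

* B. J. J. Moonen, Yu. G. Zarhin, *Hodge classes on abelian varieties of low dimension*, Math. Ann. 315 (1999),
  held `paper:arxiv-math_9901113` (the held TeX carries no statement numbers; «(2.2)» is the `g = 2` list of §2,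
  p0005 L53 ff.): §2 (p0005 L20–L22) "For `g := dim(X) ≤ 3` and `g = 5` we always find that `Hg(X) = Sp_D(V,φ)`.
  Since type III does not occur for `g ≤ 3` and `g = 5` (`X` simple!), it follows that `ℬ•(Xⁿ) = 𝒟•(Xⁿ)` for all
  `n`"; (2.2), `g = 2` (p0005 L62–L65) "Type I(2): `End⁰(X) = F` is a real quadratic field. Then there is a unique
  `F`-symplectic form `ψ : V × V → F` such that `φ = trace_{F/ℚ} ψ`. The Hodge group is given by
  `Hg(X) = Res_{F/ℚ} Sp_F(V,ψ)`" (for a surface `V` is a plane over `F`, so `Sp_F(V,ψ) = SL_{2,F}`); §3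
  (p0008 L107–L111) "Combining this with Corollary (…), we have proven (…) in case `dim(X) ≤ 3`. In particular, for
  every complex abelian variety `X` of dimension `≤ 3` we have `Hg(X) = Sp_D(V,φ)` and condition (D) in (…) is
  satisfied" (condition (D), §1 p0004 L61–L66: "`ℬ•(Xⁿ) = 𝒟•(Xⁿ)` for all `n`").  LOCATOR NOTE (p17 gen 48,
  docstring-only rider): the locators «(2.3) Remark (p0005 L81)», «(2.4) Theorem (p0005 L88–L90)» and «(p0006 L1–L4)»
  of this file as first filed, together with the sentences attached to them mentioning `L(X)`, are NOT on the held
  pages (the held TeX never writes `L(X)`; p0005 L81 ∕ L88–L90 are the Type IV(2,1) ∕ Type I(3) entries) and are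
  withdrawn here; `Hg(X) = Lf(X)` is MZ's «`Hg(X) = Sp_D(V,φ)`» read through Milne's type-I row
  «`S(A) = ∏ Res Sp(φᵢ)`, connected».  Statements and proofs are unchanged.
* J. S. Milne, *Lefschetz classes on abelian varieties*, Duke Math. J. 96 (1999), §2 Summary table (type I:
  «`S(A) = Res Sp`, Connected: Yes») and §4.
* B. B. Gordon, *A survey of the Hodge conjecture for abelian varieties* (1997∕1999), Thm. 6.2 and Thm. 7.5 («`Hg = Lf`
  ⟺ stably nondegenerate»), §5.8.

## Contents

* §1 **`IsRiemannForm.mem_hodgeGroupLieC_of_mem_lefschetzLieC_of_finrank_eq_two`** (`𝔩𝔣_ℂ ⊆ 𝔤`: an element of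
  `𝔩𝔣_ℂ` restricts tracelessly to `V_σ`, `V_τ`, so by g47-#9 agrees with some `Z' ∈ 𝔤` on `V_σ ⊕ V_τ = V_ℂ`), and
  **`IsRiemannForm.coe_hodgeGroupLieC_eq_lefschetzLieC_of_finrank_eq_two`** (`𝔤 = 𝔩𝔣_ℂ`).
* §2 **`IsRiemannForm.hodgeGroupC_eq_lefschetzIdentityC_of_finrank_eq_two`** (`Hg(X)(ℂ) = Lf(X)(ℂ)`: connected
  algebraic groups with the same Lie algebra), **`IsRiemannForm.hodgeGroup_eq_lefschetzIdentity_of_finrank_eq_two`**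
  (real points).
* §3 **`IsRiemannForm.forall_divisorClasses_powPeriod_eq_hodgeClasses_of_finrank_eq_two`** — MZ's condition (D) for
  surfaces of Type I(2): `ℬ•(Xⁿ) = 𝒟•(Xⁿ)` for every `n` (stably nondegenerate).
-/

noncomputable section

open scoped Matrix
open Module Matrix NormedSpace
open Literature.NumberTheory.Automorphic (IsZConnected IsAlgebraicSubgroup lieAlgebraGL lieSubalgebraGL)

namespace Literature.Geometry.Kaehler

namespace ComplexTorus

/-! ## §1 `𝔤 = 𝔩𝔣_ℂ` for a Type I(2) surface -/

section LieAlgebra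

variable {ι : Type*} [Fintype ι] [DecidableEq ι] {E : Type*} [NormedAddCommGroup E] [NormedSpace ℂ E]
  [FiniteDimensional ℂ E] {Φ : (ι → ℝ) ≃L[ℝ] E} {η : E [⋀^Fin 2]→L[ℝ] ℝ} {K : Type*} [Field K] [NumberField K]
  [NumberField.IsTotallyReal K]

/-- **`𝔩𝔣_ℂ ⊆ 𝔤` FOR A TYPE I(2) SURFACE**: for a polarised complex abelian surface whose endomorphism algebra
`End⁰(X) = f(K)` is a real quadratic field, every `Z ∈ 𝔩𝔣_ℂ = Lie S(X)(ℂ)` (`E`-skew, commuting with `End⁰(X)`) lies in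
`𝔤 = Lie Hg(X)(ℂ)`: `Z` preserves the eigenplanes `V_σ, V_τ` and is traceless on them (g47-#8), so by g47-#9 some
`Z' ∈ 𝔤` agrees with `Z` on `V_σ ⊕ V_τ = V_ℂ`. («`Hg(X) = Res_{F/ℚ} Sp_F(V,ψ)`», the inclusion `⊇`.)
[cite: MoonenZarhin1999LowDim, §2 (2.2) ("Type I(2) … `Hg(X) = Res_{F/ℚ} Sp_F(V,ψ)`") and §2 (p0005 L20–L22: "`Hg(X) = Sp_D(V,φ)`")] [cite: Milne1999LefschetzClasses, §2 (type I: `S(A) = ∏ Res Sp(φᵢ)`)] -/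
theorem IsRiemannForm.mem_hodgeGroupLieC_of_mem_lefschetzLieC_of_finrank_eq_two (hη : IsRiemannForm Φ η)
    (h2 : finrank ℂ E = 2) (hK : finrank ℚ K = 2) (f : K →ₐ[ℚ] Matrix ι ι ℚ) (hfE : f.range = endAlgRat Φ)
    {G : Matrix ι ι ℚ} (hGη : G.map (Rat.cast : ℚ → ℝ) = latticeGram Φ η) {Z : Matrix ι ι ℂ}
    (hZ : Z ∈ lefschetzLieC Φ G) : Z ∈ hodgeGroupLieC Φ := by
  classical
  -- two distinct complex embeddings of the quadratic field `K`
  have hcard : Fintype.card (K →+* ℂ) = 2 := by rw [NumberField.Embeddings.card, hK]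
  obtain ⟨σ, τ, hστ⟩ : ∃ σ τ : K →+* ℂ, σ ≠ τ := Fintype.exists_pair_of_one_lt_card (by omega)
  have hτσ : τ ≠ σ := fun h ↦ hστ h.symm
  set W₁ : Submodule ℂ (ι → ℂ) := ⨅ y : K, Module.End.eigenspace (Matrix.toLin' ((f y).map (algebraMap ℚ ℂ))) (σ y)
    with hW₁
  set W₂ : Submodule ℂ (ι → ℂ) := ⨅ y : K, Module.End.eigenspace (Matrix.toLin' ((f y).map (algebraMap ℚ ℂ))) (τ y)
    with hW₂
  have hfE' : ∀ y, f y ∈ endAlgRat Φ := fun y ↦ by rw [← hfE]; exact AlgHom.mem_range_self f y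
  have hsup₁₂ : W₁ ⊔ W₂ = ⊤ := sup_iInf_eigenspace_eq_top_of_finrank_eq_two f hK hστ
  have hsup₂₁ : W₂ ⊔ W₁ = ⊤ := sup_iInf_eigenspace_eq_top_of_finrank_eq_two f hK hτσ
  -- Rosati is the identity on the totally real `f(K) = End⁰(X)`; the Gram matrix is invertible and alternating
  have hcardι : Fintype.card ι = 4 := by rw [card_eq_two_mul_finrank Φ, h2]
  haveI : Nonempty ι := Fintype.card_pos_iff.1 (by omega)
  have hGu : IsUnit G.det := isUnit_det_of_map_ratCast hGη hη.isUnit_det_latticeGram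
  have hGt : Gᵀ = -G := transpose_eq_neg_of_map_ratCast Φ hGη
  have hRos : ∀ A ∈ endAlgRat Φ, rosati G A = A := fun A hA ↦
    rosati_eq_self_of_range_eq Φ f hfE hη.1 hη.2.2 hGη hA
  have hsym : ∀ a : K, (f a)ᵀ * G = G * f a := forall_transpose_mul_eq_of_forall_rosati_eq f hfE' hGu hRos
  -- `Z` preserves `W₁`, `W₂` and is traceless on them
  have hZW₁ : ∀ w ∈ W₁, Matrix.toLin' Z w ∈ W₁ := toLin'_apply_mem_iInf_eigenspace_algHom_of_mem_lefschetzLieC f hfE' σ hZ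
  have hZW₂ : ∀ w ∈ W₂, Matrix.toLin' Z w ∈ W₂ := toLin'_apply_mem_iInf_eigenspace_algHom_of_mem_lefschetzLieC f hfE' τ hZ
  have htr₁ : LinearMap.trace ℂ W₁ ((Matrix.toLin' Z).restrict hZW₁) = 0 :=
    forall_trace_restrict_eq_zero_of_mem_lefschetzLieC f hGu.ne_zero hGt hsym hστ hsup₁₂ hZ hZW₁
  have htr₂ : LinearMap.trace ℂ W₂ ((Matrix.toLin' Z).restrict hZW₂) = 0 :=
    forall_trace_restrict_eq_zero_of_mem_lefschetzLieC f hGu.ne_zero hGt hsym hτσ hsup₂₁ hZ hZW₂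
  -- lift the pair of restrictions through `𝔤`
  obtain ⟨Z', hZ', h₁, h₂⟩ := hη.exists_mem_hodgeGroupLieC_forall_mulVec_eq_of_trace_eq_zero h2 hK f hfE hστ hW₁ hW₂
    ((Matrix.toLin' Z).restrict hZW₁) htr₁ ((Matrix.toLin' Z).restrict hZW₂) htr₂
  -- `Z` and `Z'` agree on `W₁ ⊕ W₂ = V_ℂ`
  have hagree : ∀ v : ι → ℂ, Z *ᵥ v = Z' *ᵥ v := fun v ↦ by
    have hv : v ∈ W₁ ⊔ W₂ := by rw [hsup₁₂]; exact Submodule.mem_top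
    obtain ⟨x, hx, y, hy, rfl⟩ := Submodule.mem_sup.1 hv
    have hx' := h₁ ⟨x, hx⟩
    have hy' := h₂ ⟨y, hy⟩
    rw [LinearMap.coe_restrict_apply, Matrix.toLin'_apply] at hx' hy'
    rw [Matrix.mulVec_add, Matrix.mulVec_add, ← hx', ← hy']
  have hZZ' : Z = Z' := Matrix.toLin'.injective (LinearMap.ext fun v ↦ by
    rw [Matrix.toLin'_apply, Matrix.toLin'_apply, hagree v])
  rw [hZZ']
  exact hZ'

/-- **`𝔤 = 𝔩𝔣_ℂ` FOR A TYPE I(2) SURFACE** (as subsets of `M_ι(ℂ)`): «`Hg(X) = Res_{F/ℚ} Sp_F(V, ψ)`» at the Lie algebra,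
over `ℂ`. [cite: MoonenZarhin1999LowDim, §2 (2.2) ("Type I(2)": `Hg(X) = Res_{F/ℚ} Sp_F(V,ψ)`)] [cite: Milne1999LefschetzClasses, §4 ("Lie Hg(A) ⊂ ⊕ Lie S(Aᵢ)")] -/
theorem IsRiemannForm.coe_hodgeGroupLieC_eq_lefschetzLieC_of_finrank_eq_two (hη : IsRiemannForm Φ η)
    (h2 : finrank ℂ E = 2) (hK : finrank ℚ K = 2) (f : K →ₐ[ℚ] Matrix ι ι ℚ) (hfE : f.range = endAlgRat Φ)
    {G : Matrix ι ι ℚ} (hGη : G.map (Rat.cast : ℚ → ℝ) = latticeGram Φ η) :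
    (hodgeGroupLieC Φ : Set (Matrix ι ι ℂ)) = lefschetzLieC Φ G :=
  Set.Subset.antisymm (hη.hodgeGroupLieC_subset_lefschetzLieC hGη)
    fun _ hZ ↦ hη.mem_hodgeGroupLieC_of_mem_lefschetzLieC_of_finrank_eq_two h2 hK f hfE hGη hZ

end LieAlgebra

/-! ## §2 `Hg(X)(ℂ) = Lf(X)(ℂ)` and `Hg(X)(ℝ) = Lf(X)(ℝ)` -/

section Groups

variable {ι : Type*} [Fintype ι] [DecidableEq ι] {E : Type*} [NormedAddCommGroup E] [NormedSpace ℂ E]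
  [FiniteDimensional ℂ E] {Φ : (ι → ℝ) ≃L[ℝ] E} {η : E [⋀^Fin 2]→L[ℝ] ℝ} {K : Type*} [Field K] [NumberField K]
  [NumberField.IsTotallyReal K]

omit [FiniteDimensional ℂ E] in
/-- `∃ M ∈ Lf(X)(ℂ), M = A` iff `∃ g ∈ Lf(X)(ℂ) ≤ GL(V_ℂ), g = A`. [folklore] -/
private theorem exists_mem_lefschetzIdentityC_coe_eq_iff (Φ : (ι → ℝ) ≃L[ℝ] E) (G : Matrix ι ι ℚ) {A : Matrix ι ι ℂ} :
    (∃ M ∈ lefschetzIdentityC Φ G, (M : Matrix ι ι ℂ) = A) ↔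
      ∃ g ∈ (lefschetzIdentityC Φ G).map Matrix.SpecialLinearGroup.toGL, ((g : GL ι ℂ) : Matrix ι ι ℂ) = A := by
  constructor
  · rintro ⟨M, hM, hMA⟩
    exact ⟨Matrix.SpecialLinearGroup.toGL M, Subgroup.mem_map_of_mem _ hM, by
      rw [Matrix.SpecialLinearGroup.coe_GL_coe_matrix, hMA]⟩
  · rintro ⟨g, hg, hgA⟩
    obtain ⟨M, hM, rfl⟩ := Subgroup.mem_map.1 hg
    exact ⟨M, hM, by rw [← hgA, Matrix.SpecialLinearGroup.coe_GL_coe_matrix]⟩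

/-- **MOONEN–ZARHIN (2.2), TYPE I(2): `Hg(X)(ℂ) = Lf(X)(ℂ)`** for a polarised complex abelian surface whose
endomorphism algebra is a real quadratic field: the two connected algebraic subgroups of `GL(V_ℂ)` have the same Lie
algebra `𝔤 = 𝔩𝔣_ℂ` (§1), hence coincide («`Hg(X) = Res_{F/ℚ} Sp_F(V,ψ)`», `= Res_{F/ℚ} SL_{2,F}` for a surface;
`Lf(X)(ℂ) = S(X)(ℂ) ≅ SL₂(ℂ) × SL₂(ℂ)` by Milne's table, type I). [cite: MoonenZarhin1999LowDim, §2 (2.2) ("Type I(2) … The Hodge group is given by `Hg(X) = Res_{F/ℚ} Sp_F(V,ψ)`") and §2 (p0005 L20–L22)]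
[cite: Milne1999LefschetzClasses, §2 Summary table (type I) and §4] [cite: TauvelYu2005, 24.3.5 (ii)] -/
theorem IsRiemannForm.hodgeGroupC_eq_lefschetzIdentityC_of_finrank_eq_two (hη : IsRiemannForm Φ η)
    (h2 : finrank ℂ E = 2) (hK : finrank ℚ K = 2) (f : K →ₐ[ℚ] Matrix ι ι ℚ) (hfE : f.range = endAlgRat Φ)
    {G : Matrix ι ι ℚ} (hGη : G.map (Rat.cast : ℚ → ℝ) = latticeGram Φ η) :
    hodgeGroupC Φ = lefschetzIdentityC Φ G := by
  letI : LieRing (Matrix ι ι ℂ) := LieRing.ofAssociativeRing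
  letI : LieAlgebra ℂ (Matrix ι ι ℂ) := LieAlgebra.ofAssociativeAlgebra
  have hGdet : G.det ≠ 0 := (isUnit_det_of_map_ratCast hGη hη.isUnit_det_latticeGram).ne_zero
  obtain ⟨hconn, halg, -, -⟩ := isZConnected_map_toGL_lefschetzIdentityC Φ G
  have hset := hη.coe_hodgeGroupLieC_eq_lefschetzLieC_of_finrank_eq_two h2 hK f hfE hGη
  -- `𝔤 = Lie(Lf(X)(ℂ))` as Lie subalgebras of `𝔤𝔩(V_ℂ)`
  have hLie : hodgeGroupComplexLie Φ =
      lieSubalgebraGL ((lefschetzIdentityC Φ G).map Matrix.SpecialLinearGroup.toGL) := by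
    refine LieSubalgebra.ext _ _ fun Z ↦ ?_
    rw [mem_hodgeGroupComplexLie_iff_mem_hodgeGroupLieC, Literature.NumberTheory.Automorphic.mem_lieSubalgebraGL_iff,
      Literature.NumberTheory.Automorphic.mem_lieAlgebraGL_iff_forall_real_exp_smul_mem halg, ← SetLike.mem_coe, hset,
      SetLike.mem_coe, mem_lefschetzLieC_iff_forall_exp_mem_lefschetzIdentityC hGdet]
    refine forall_congr' fun t ↦ ?_
    rw [Complex.coe_smul]
    exact exists_mem_lefschetzIdentityC_coe_eq_iff Φ G
  have hmap := (map_toGL_hodgeGroupC_eq_iff_hodgeGroupComplexLie_eq_lieSubalgebraGL Φ hconn).2 hLie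
  exact Subgroup.map_injective Matrix.SpecialLinearGroup.toGL_injective hmap

/-- **Real points: `Hg(X)(ℝ) = Lf(X)(ℝ)`** for a Type I(2) surface. [cite: MoonenZarhin1999LowDim, §2 (2.2) ("Type I(2)") and §3 (p0008 L107–L111)]
[cite: Milne1999LefschetzClasses, §4 Prop. 4.8] -/
theorem IsRiemannForm.hodgeGroup_eq_lefschetzIdentity_of_finrank_eq_two (hη : IsRiemannForm Φ η)
    (h2 : finrank ℂ E = 2) (hK : finrank ℚ K = 2) (f : K →ₐ[ℚ] Matrix ι ι ℚ) (hfE : f.range = endAlgRat Φ)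
    {G : Matrix ι ι ℚ} (hGη : G.map (Rat.cast : ℚ → ℝ) = latticeGram Φ η) :
    hodgeGroup Φ = lefschetzIdentity Φ G :=
  hodgeGroup_eq_lefschetzIdentity_of_hodgeGroupC_eq_lefschetzIdentityC
    (hη.hodgeGroupC_eq_lefschetzIdentityC_of_finrank_eq_two h2 hK f hfE hGη)

end Groups

/-! ## §3 Moonen–Zarhin's condition (D) for surfaces of Type I(2): stably nondegenerate -/

section StablyNondegenerate

variable {ι : Type} [Fintype ι] [DecidableEq ι] {E : Type} [NormedAddCommGroup E] [NormedSpace ℂ E]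
  [FiniteDimensional ℂ E] {Φ : (ι → ℝ) ≃L[ℝ] E} {η : E [⋀^Fin 2]→L[ℝ] ℝ} {K : Type*} [Field K] [NumberField K]
  [NumberField.IsTotallyReal K]

/-- **MOONEN–ZARHIN, CONDITION (D) FOR SURFACES OF TYPE I(2): `ℬ•(Xⁿ) = 𝒟•(Xⁿ)` for every `n`** — a polarised complex abelian
surface with multiplication by a real quadratic field `End⁰(X) = f(K)` is STABLY NONDEGENERATE: on every power
`Xᵏ = E^k/Φ^k(ℤ^{ι×k})` and in every codimension `p`, the Hodge classes are generated by divisor classes (hence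
algebraic).  From `Hg(X) = Lf(X)` (§2) and the stably-nondegenerate criterion for commutative `End⁰(X)` (Gordon
Thm. 7.5, Milne Prop. 4.8). [cite: MoonenZarhin1999LowDim, §3 (p0008 L107–L111: "for every complex abelian variety `X` of dimension `≤ 3` we have `Hg(X) = Sp_D(V,φ)` and condition (D) … is satisfied"), §1 (D) (p0004 L61–L66) and §2 (p0005 L20–L22)]
[cite: Gordon1999HodgeAVSurvey, Thm. 6.2 and Thm. 7.5] [cite: Milne1999LefschetzClasses, §4 Prop. 4.8] -/
theorem IsRiemannForm.forall_divisorClasses_powPeriod_eq_hodgeClasses_of_finrank_eq_two (hη : IsRiemannForm Φ η)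
    (h2 : finrank ℂ E = 2) (hK : finrank ℚ K = 2) (f : K →ₐ[ℚ] Matrix ι ι ℚ) (hfE : f.range = endAlgRat Φ) :
    ∀ k p : ℕ, divisorClasses (powPeriod Φ k) p = hodgeClasses (powPeriod Φ k) p := by
  obtain ⟨G, hGη⟩ := hη.exists_ratMatrix_latticeGram
  have hcomm : ∀ a ∈ endAlgRat Φ, ∀ b ∈ endAlgRat Φ, a * b = b * a := fun a ha b hb ↦ by
    rw [← hfE] at ha hb
    obtain ⟨x, rfl⟩ := (AlgHom.mem_range f).1 ha
    obtain ⟨y, rfl⟩ := (AlgHom.mem_range f).1 hb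
    rw [← map_mul, ← map_mul, mul_comm]
  exact (hη.forall_divisorClasses_powPeriod_eq_hodgeClasses_iff_hodgeGroup_eq_lefschetzIdentity_of_endAlgRat_comm hGη
    (by omega) hcomm).2 (hη.hodgeGroup_eq_lefschetzIdentity_of_finrank_eq_two h2 hK f hfE hGη)

end StablyNondegenerate

end ComplexTorus

end Literature.Geometry.Kaehler
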